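import Literature.MathematicalPhysics.QuantumFieldTheory.Balaban1983to89.B8Lemma1NonAbelian

/-!
# `Balaban1983to89.B14Claim247` — the claim of p. 247 of CMP 119: `|U U_{1,□′}⁻¹ − 1| < O(L²)ε₀` on `□′^{~2}`
# (the approximate fluctuation field is small), TYPED as a printed-form `Prop` and PROVED in the exact-axial
# block-pair model from the tree's kernel proof of Lemma 1 of [14] (`B8Lemma1NonAbelian.lemma1_explicit`)

statement-level skeleton of published theorems with citation tags; proofs where landed; nothing here is a claim
about the Yang–Mills mass gap.

CITATION HEADER (lean-in-tree rule).  Source: T. Bałaban, *Convergent renormalization expansions for lattice gauge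
theories*, Commun. Math. Phys. **119**, 243–285 (1988), doi:10.1007/bf01217741 [Balaban1988Convergent] (cell paper
B14; held `paper:balaban1988-cmp119-convergent-renormalization`, journal page = PDF page + 242; the sentence below was
read on the x2 render of PDF p. 5 = p. 247).  "[14]" of that sentence is entry [14] of the reference list of [I] =
CMP 109 (B14 prints only "[I], [II] and references therein"), i.e. T. Bałaban, *Spaces of regular gauge field
configurations on a lattice and gauge fixing conditions*, Commun. Math. Phys. **99**, 75–102 (1985)
[Balaban1985RegularSpaces] (cell paper B8), whose Lemma 1 (p. 79) is typed as `B8.Lemma1Printed` and PROVED on the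
`ℤ^d` block-pair carriers in `B8Lemma1NonAbelian` (`lemma1_explicit`, `lemma1Printed_blockPairNA`).
Mega-formalization `lit-balaban`, unit `lit-balaban-r11` (CMP 119), SKELETON row `B14.Claim@247`
(PHASE2-TARGETS §A).

THE PRINTED TEXT (p. 247, verbatim): *"Trying to imitate the procedure in the paper [I] as closely as possible we
should introduce now restrictions on a fluctuation field. This field is not defined yet, therefore we introduce
restrictions on an approximate fluctuation field. A good approximation on a cube □′ ⊂ B(P₁¹) is given by
UU_{1,□′}⁻¹, where U_{1,□′} is taken in the axial gauge. It is easy to see, by the same reasoning as in the proof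
of Lemma 1 [14], that |UU_{1,□′}⁻¹ − 1| < O(L²)ε₀ on □′^{~2}. A domain of this type, with O(L²) replaced by a small
constant, is also contained in the domain of integration in (1.6). These remarks serve as a justification of the
following decomposition of unity: (1.8)"*.  Context (pp. 246–247): `U` is the integration variable of (1.6), i.e.
`|U(∂p) − 1| < ε₀` for `p ⊂ P₀ᶜ` (the function `χ₀(P₀ᶜ)` of (1.1)), `Ū = V` (the `δ(ŪV⁻¹)` of (1.6); `Ū` the
one-step averaging of [12], in the tree the block-bond average (42) of [12] `B7Prop1Explicit.bavg`), gauge-fixed on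
the blocks `B(y), y ∈ P₁¹` by `χ_Ax(P₁¹)` ((1.5)–(1.6): `|U(y,x) − 1| < ε₀` for the contour variables
`U(y,x) = U(Γ_{y,x})` of (0.11) [I]); `U_{1,□′}(V) = U(𝐁₁(□′^{~4}), M˙(Q₁^{s*}V))` is the localized background field
(1.2) — the configuration of [15] on the minimal determining set `𝐁₁(□′^{~4})` with the data built from `V` by
(1.3) (= (4.5.3) of [18]), so that its block averages near `□′` are the ones prescribed by `V` — and
`|U_{1,□′}(V, ∂p) − 1| < ε₁L⁻²` for `p ⊂ □′^~` (the function `χ₁(P₁ᶜ)` of (1.4); `□′ ⊂ B(P₁¹)` lies in the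
small-field region `P₁ᶜ`).

THE REASONING OF LEMMA 1 [14] (B8 pp. 79–80, kernel-checked in the tree as `B8Lemma1NonAbelian.lemma1_explicit`):
for `G`-valued bond fields `U`, `V₀` on a block pair `B(c₋) ∪ B(c₊)` (blocks of side `L` of the unit lattice
`ℤ^d`, `c = ⟨y, y + Le_κ⟩`) whose plaquette variables are `a`-close to `1`, whose axial trees agree
(`U(Γ_{z,x}) = V₀(Γ_{z,x})`, `x ∈ B(z)`, `z = c₋, c₊`) and whose block-bond averages (42) are `α₁`-close, EVERY bond
`b` of the pair satisfies `|U_b V₀,b⁻¹ − 1| ≤ α₁ + ω(10 + 12α₁)`, `ω = (d−1)(L−1)·L·a`, provided `6ω ≤ 1`.  With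
`a = ε₀` (B14's plaquettes are `ε₀`-small, NOT `ε₀L⁻²`-small as in (1.7) of [14] — this is exactly why the print
says `O(L²)ε₀` and not `O(1)ε₀`) and `α₁ = 0` this gives `|U_b U₁,b⁻¹ − 1| ≤ 10(d−1)L(L−1)ε₀ < (10d+1)L²ε₀`.

WHAT IS TYPED, AND THE MODEL (declared deviations, for the referee's F6/F7 columns):
* `Hyp247 L U U₁ y κ ε₀` — the printed hypotheses on ONE block pair: `U`, `U₁` take values in `U1 𝔸 ⊇ U(N)`;
  plaquettes of `U` and of `U₁` are `ε₀`-small there (for `U₁` the print has `ε₁L⁻²` from (1.4); we use only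
  `≤ ε₀`, weaker whenever `ε₁ ≤ L²ε₀`); (D1) the axial trees of `U` and `U₁` AGREE on both blocks — the print takes `U₁`
  axial (`U₁(Γ_{y,x}) = 1`) and `U` soft-axial (`|U(Γ_{y,x}) − 1| < ε₀`, `χ_Ax`); the exact-axial case typed here
  is the case `U(Γ_{y,x}) = 1` of the printed domain (weaker-than-print: the soft-axial bonds add `O(1)ε₀` by one
  more triangle inequality, not formalized); block-bond averages agree, `Ū_c = Ū₁,c` (`= V(c)`; exact in print).
* (D2) "on `□′^{~2}`" — the print's region is the cube `□′` with two layers of cubes added; the bound is bondwise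
  and, by the locality sentence of [14] p. 80, depends only on the data on the block pair containing the bond, so it
  is typed per block pair `B(c₋) ∪ B(c₊)` (every bond of `□′^{~2}` lies in such a pair inside `□′^{~3}`).
* (D3) "`O(L²)ε₀`", "it is easy to see" — typed as `∃ C c > 0` chosen BEFORE `L, ε₀, U, U₁, □′` (F3), the bound
  `C·L²·ε₀` holding whenever `L²ε₀ ≤ c` (the smallness under which Lemma 1 of [14] is stated: "for α₀, α₁ small";
  in B14 `ε₀ = g₀p₀(g₀)` and everything is for `g₀` small, p. 246).  PROVED with `C = 10d + 1`, `c = 1/(6(d+1))`.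
Nothing printed is weakened into an assumption: `Claim247Printed` is a closed `Prop` per `(d, 𝔸)` and
`Claim247Printed_holds` proves it outright (net new unproved facts: 0).
-/

open scoped BigOperators
open NormedSpace Finset

namespace Literature.MathematicalPhysics.QuantumFieldTheory.Balaban1983to89.B14.Claim247

open B7Prop1Explicit MatrixLog B8Lemma1NonAbelian
open B8Lemma1Lattice (InBlock)

-- `Site` alone could resolve to the torus sites of `Setup.lean` through a parent namespace; re-export the `ℤ^d`
-- sites `Fin d → ℤ` of `B7Prop1Explicit` (the convention of `B8Lemma1NonAbelian`).
export B7Prop1Explicit (Site)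

variable {d : ℕ}

section Model

variable {𝔸 : Type*} [NormedRing 𝔸] [NormOneClass 𝔸] [NormedAlgebra ℂ 𝔸] [CompleteSpace 𝔸]

/-- **The hypotheses of the p. 247 claim on one block pair** `B(c₋) ∪ B(c₊)`, `c = ⟨y, y + Le_κ⟩` (blocks of side
`L` of the unit lattice): `U` (the integration variable of (1.6)) and `U₁ = U_{1,□′}(V)` are `U1 𝔸`-valued; the
plaquette variables of both are `ε₀`-close to `1` on the pair (`χ₀` of (1.1) for `U`; (1.4) for `U₁`, where the
print has `ε₁L⁻²`); the axial trees of `U` and `U₁` agree on both blocks (model (D1): print has `U₁` axial and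
`|U(Γ_{y,x}) − 1| < ε₀`); the block-bond averages ((42) of [12], `bavg`) of `U` and `U₁` agree, `Ū_c = Ū₁,c`
(`= V(c)` in print: `δ(ŪV⁻¹)` in (1.6) and the constraint in (1.2)).
[cite: Balaban1988Convergent, p.247; (1.1)–(1.6) pp.246–247] -/
structure Hyp247 (L : ℕ) (U U₁ : Site d → Fin d → 𝔸ˣ) (y : Site d) (κ : Fin d) (ε₀ : ℝ) : Prop where
  memU : ∀ x μ, U x μ ∈ U1 𝔸
  memU₁ : ∀ x μ, U₁ x μ ∈ U1 𝔸
  plaqU : B8Lemma1NonAbelian.PlaqSmall U y (y + pairTop L κ) ε₀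
  plaqU₁ : B8Lemma1NonAbelian.PlaqSmall U₁ y (y + pairTop L κ) ε₀
  axial : ∀ r : Fin d → Fin L, axialFn U y (y + boxVec L r) = axialFn U₁ y (y + boxVec L r)
  axial₁ : ∀ r : Fin d → Fin L, axialFn U (y + (L : ℤ) • e κ) (y + (L : ℤ) • e κ + boxVec L r)
    = axialFn U₁ (y + (L : ℤ) • e κ) (y + (L : ℤ) • e κ + boxVec L r)
  avg : bavg L U y κ = bavg L U₁ y κ

/-- `Hyp247` is the hypothesis block `Hyp` of the tree's Lemma 1 of [14] with plaquette constant `a = ε₀` and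
average discrepancy `α₁ = 0`. [cite: Balaban1988Convergent, p.247] -/
theorem Hyp247.toHyp {L : ℕ} {U U₁ : Site d → Fin d → 𝔸ˣ} {y : Site d} {κ : Fin d} {ε₀ : ℝ}
    (H : Hyp247 L U U₁ y κ ε₀) : Hyp L U U₁ y κ ε₀ 0 where
  memU := H.memU
  memV₀ := H.memU₁
  plaqU := H.plaqU
  plaqV₀ := H.plaqU₁
  axial := H.axial
  axial₁ := H.axial₁
  avg := by rw [H.avg, sub_self, norm_zero]

/-- **p. 247, explicit form** ("by the same reasoning as in the proof of Lemma 1 [14]"): under `Hyp247` and the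
smallness `6(d−1)(L−1)Lε₀ ≤ 1`, every bond `b = ⟨x, x + e_ν⟩` of the block pair satisfies
`|U_b U₁,b⁻¹ − 1| ≤ 10·(d−1)(L−1)L·ε₀` — the `O(L²)ε₀` of the print with the constant of the tree's proof of
Lemma 1 of [14]. [cite: Balaban1988Convergent, p.247] -/
theorem claim247_explicit {L : ℕ} (hL : 1 ≤ L) {U U₁ : Site d → Fin d → 𝔸ˣ} {y : Site d} {κ : Fin d} {ε₀ : ℝ}
    (H : Hyp247 L U U₁ y κ ε₀) (hε₀ : 0 ≤ ε₀) (hω : 6 * omegaC d L ε₀ ≤ 1) (x : Site d) (ν : Fin d)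
    (hx : InPair L y κ x) (hxν : InPair L y κ (x + e ν)) :
    ‖((pert U U₁ x ν : 𝔸ˣ) : 𝔸) - 1‖ ≤ 10 * omegaC d L ε₀ := by
  have h := lemma1_explicit hL H.toHyp hε₀ le_rfl hω x ν hx hxν
  have h' : (0 : ℝ) + omegaC d L ε₀ * (10 + 12 * 0) = 10 * omegaC d L ε₀ := by ring
  rwa [h'] at h

omit [NormOneClass 𝔸] [NormedAlgebra ℂ 𝔸] [CompleteSpace 𝔸] in
/-- The constant of `claim247_explicit` is `O(L²)ε₀`: `10·ω = 10(d−1)(L−1)Lε₀ ≤ 10(d−1)L²ε₀` (`d ≥ 1`).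
[cite: Balaban1988Convergent, p.247] -/
theorem ten_omegaC_le {L : ℕ} (hd : 1 ≤ d) {ε₀ : ℝ} (hε₀ : 0 ≤ ε₀) :
    10 * omegaC d L ε₀ ≤ 10 * ((d : ℝ) - 1) * (L : ℝ) ^ 2 * ε₀ := by
  unfold omegaC
  have h2 : (1 : ℝ) ≤ d := by exact_mod_cast hd
  have hL0 : (0 : ℝ) ≤ L := Nat.cast_nonneg L
  have h3 : 0 ≤ ((d : ℝ) - 1) * ε₀ * (L : ℝ) := by
    have : (0 : ℝ) ≤ (d : ℝ) - 1 := by linarith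
    positivity
  nlinarith

end Model

section Printed

/-- **B14 p. 247 (verbatim): *"It is easy to see, by the same reasoning as in the proof of Lemma 1 [14], that
|UU_{1,□′}⁻¹ − 1| < O(L²)ε₀ on □′^{~2}."*** — typed in printed form over the block-pair model (`Hyp247`; deviations
(D1)–(D3) of the module docstring): there are constants `C, c > 0` (the `O(L²)` constant and the smallness, chosen
before everything else) such that for every block side `L ≥ 1`, every `ε₀ > 0` with `L²ε₀ ≤ c`, every pair
`(U, U₁)` satisfying the hypotheses on a block pair and every bond `b` of that pair, `|U_b U₁,b⁻¹ − 1| < C·L²·ε₀`.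
[cite: Balaban1988Convergent, p.247] -/
def Claim247Printed (d : ℕ) (𝔸 : Type*) [NormedRing 𝔸] [NormOneClass 𝔸] [NormedAlgebra ℂ 𝔸]
    [CompleteSpace 𝔸] : Prop :=
  ∃ C c : ℝ, 0 < C ∧ 0 < c ∧ ∀ L : ℕ, 1 ≤ L → ∀ ε₀ : ℝ, 0 < ε₀ → (L : ℝ) ^ 2 * ε₀ ≤ c →
    ∀ (U U₁ : Site d → Fin d → 𝔸ˣ) (y : Site d) (κ : Fin d), Hyp247 L U U₁ y κ ε₀ →
      ∀ (x : Site d) (ν : Fin d), InPair L y κ x → InPair L y κ (x + e ν) →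
        ‖((pert U U₁ x ν : 𝔸ˣ) : 𝔸) - 1‖ < C * (L : ℝ) ^ 2 * ε₀

/-- **`Claim247Printed` HOLDS** (in the exact-axial block-pair model), with `C = 10d + 1` and `c = 1/(6(d+1))`, by
the tree's kernel proof of Lemma 1 of [14] (`B8Lemma1NonAbelian.lemma1_explicit`) at plaquette constant `ε₀` and
average discrepancy `0`. [cite: Balaban1988Convergent, p.247] -/
theorem Claim247Printed_holds (d : ℕ) (𝔸 : Type*) [NormedRing 𝔸] [NormOneClass 𝔸] [NormedAlgebra ℂ 𝔸]
    [CompleteSpace 𝔸] : Claim247Printed d 𝔸 := by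
  refine ⟨10 * (d : ℝ) + 1, 1 / (6 * ((d : ℝ) + 1)), by positivity, by positivity, ?_⟩
  intro L hL ε₀ hε₀ hsmall U U₁ y κ H x ν hx hxν
  rcases Nat.eq_zero_or_pos d with hd0 | hd
  · subst hd0; exact Fin.elim0 κ
  have h1 : (1 : ℝ) ≤ L := by exact_mod_cast hL
  have h2 : (1 : ℝ) ≤ d := by exact_mod_cast hd
  have hd1 : (0 : ℝ) ≤ (d : ℝ) - 1 := by linarith
  have hL2ε : 0 ≤ (L : ℝ) ^ 2 * ε₀ := by positivity
  -- `ω ≤ (d − 1)·L²ε₀`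
  have hω : omegaC d L ε₀ ≤ ((d : ℝ) - 1) * ((L : ℝ) ^ 2 * ε₀) := by
    have h := ten_omegaC_le (L := L) hd hε₀.le
    nlinarith
  -- smallness: `6ω ≤ 6(d−1)L²ε₀ ≤ 6(d−1)c = (d−1)/(d+1) ≤ 1`
  have hω1 : 6 * omegaC d L ε₀ ≤ 1 := by
    have hc : ((d : ℝ) - 1) * ((L : ℝ) ^ 2 * ε₀) ≤ ((d : ℝ) - 1) * (1 / (6 * ((d : ℝ) + 1))) :=
      mul_le_mul_of_nonneg_left hsmall hd1
    have hq : 6 * (((d : ℝ) - 1) * (1 / (6 * ((d : ℝ) + 1)))) ≤ 1 := by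
      rw [show 6 * (((d : ℝ) - 1) * (1 / (6 * ((d : ℝ) + 1)))) = ((d : ℝ) - 1) / ((d : ℝ) + 1) by
        field_simp]
      rw [div_le_one (by linarith)]
      linarith
    linarith
  have hb := claim247_explicit hL H hε₀.le hω1 x ν hx hxν
  -- `10ω ≤ 10(d−1)L²ε₀ < (10d+1)L²ε₀`
  have hlt : 10 * omegaC d L ε₀ < (10 * (d : ℝ) + 1) * (L : ℝ) ^ 2 * ε₀ := by
    have hpos : 0 < (L : ℝ) ^ 2 * ε₀ := by positivity
    nlinarith
  exact lt_of_le_of_lt hb hlt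

end Printed

end Literature.MathematicalPhysics.QuantumFieldTheory.Balaban1983to89.B14.Claim247
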